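import Mathlib.Geometry.Manifold.VectorField.Pullback
import Mathlib.Geometry.Manifold.IntegralCurve.Basic
import HarnessLib

/-!
# Pushing a vector field forward along a map given with a local inverse

Infrastructure for Milnor's adjustments of a gradient-like vector field (Milnor, *Lectures on
the h-cobordism theorem* (1965), proof of Thm. 4.4 and Lemma 4.7, PDF pp. 24–25: the new field
on a slab is *"`ξ' = (φ ∘ H ∘ φ⁻¹)_* ξ̂`"*, the push-forward of the normalised field along a
diffeomorphism of the slab).  Mathlib has the **pull-back** of a vector field along a map with
invertible differential, `VectorField.mpullback I I' f V x = (mfderiv f x)⁻¹ (V (f x))`, and its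
smoothness (`ContMDiffAt.mpullback_vectorField_preimage`); the push-forward along `Φ` is the
pull-back along its inverse `Ψ`.  This file supplies the elementary calculus of a pair of maps
`Φ : M → M'`, `Ψ : M' → M` inverse to each other *near a point* — which is what one has for
diffeomorphisms between open subsets — everything **proved**:

* `isInvertible_mfderiv_of_eventuallyEq` — if `Ψ ∘ Φ = id` near `x` and `Φ ∘ Ψ = id` near
  `Φ x` then `dΦₓ` is invertible with inverse `dΨ_{Φ x}` (chain rule);
* `mpullback_apply_eq_mfderiv_apply`, `mpullback_apply_eq_mfderiv` — hence the pull-back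
  along `Ψ` is the push-forward along `Φ`: `mpullback Ψ Y p = dΦ_{Ψ p} (Y (Ψ p))`;
* `HasMFDerivWithinAt.comp_mpullback`, `IsMIntegralCurveOn.comp_mpullback` — **`Φ` carries
  integral curves of `Y` to integral curves of the push-forward** `mpullback Ψ Y`;
* `mfderiv_apply_eq_of_comp_eventuallyEq` — if `Θ ∘ γ = γ'` near `0` then `dΘ` carries the
  velocity of `γ` at `0` to that of `γ'`; so a map intertwining the integral curves of `Y`
  through `p` and `Ψ p` has push-forward `Y` at `p` (`mpullback_apply_eq_self`: Milnor's
  *"`ξ'` coincides with `ξ̂` near `f⁻¹(a)` and `f⁻¹(½)`"*);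
* `mfderiv_apply_mpullback` — `dg_p (mpullback Ψ Y p) = d(g ∘ Φ)_{Ψ p} (Y (Ψ p))`, so that a
  push-forward along a map preserving the levels of `g` has the same `g`-derivative as `Y`
  (Milnor: *"and satisfies `ξ'(f) = 1` identically"*).

## References

* J. Milnor, *Lectures on the h-cobordism theorem*, notes by L. Siebenmann and J. Sondow,
  Princeton Mathematical Notes (1965), proof of Thm. 4.4 and Lemma 4.7 (PDF pp. 24–25).
  [MilnorHCobordism1965]
* J. M. Lee, *Introduction to Smooth Manifolds*, 2nd ed., GTM 218 (2012), Prop. 8.19,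
  Prop. 9.6, Cor. 9.14 (push-forwards of vector fields; naturality of integral curves).
  [LeeSmoothManifolds2013]
-/

open scoped Manifold ContDiff Topology
open Set Function Filter VectorField

noncomputable section

namespace Literature.Topology.FourManifolds

section LocalInverse

variable {E : Type*} [NormedAddCommGroup E] [NormedSpace ℝ E] {H : Type*} [TopologicalSpace H]
  {I : ModelWithCorners ℝ E H} {M : Type*} [TopologicalSpace M] [ChartedSpace H M]
  {E' : Type*} [NormedAddCommGroup E'] [NormedSpace ℝ E'] {H' : Type*} [TopologicalSpace H']
  {I' : ModelWithCorners ℝ E' H'} {M' : Type*} [TopologicalSpace M'] [ChartedSpace H' M']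
  {Φ : M → M'} {Ψ : M' → M} {x : M} {p : M'}

set_option backward.isDefEq.respectTransparency false in
/-- **The differential of a map with a local inverse is invertible, with inverse the
differential of the inverse** (chain rule applied to `Ψ ∘ Φ = id` near `x` and to
`Φ ∘ Ψ = id` near `Φ x`). [cite: LeeSmoothManifolds2013, Prop. 3.6 (d)] -/
theorem isInvertible_mfderiv_of_eventuallyEq (hΦ : MDifferentiableAt I I' Φ x)
    (hΨ : MDifferentiableAt I' I Ψ (Φ x)) (h₁ : Ψ ∘ Φ =ᶠ[𝓝 x] id)
    (h₂ : Φ ∘ Ψ =ᶠ[𝓝 (Φ x)] id) :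
    (mfderiv I I' Φ x).IsInvertible ∧
      (mfderiv I I' Φ x).inverse = mfderiv I' I Ψ (Φ x) := by
  have hx : Ψ (Φ x) = x := by
    have h := h₁.self_of_nhds
    simpa only [comp_apply, id_eq] using h
  set A : E →L[ℝ] E' := mfderiv I I' Φ x with hA
  set B : E' →L[ℝ] E := mfderiv I' I Ψ (Φ x) with hB
  -- `B ∘ A = id`
  have hBA : ∀ v, B (A v) = v := by
    intro v
    have h := mfderiv_comp_apply (I' := I') x hΨ hΦ v
    rw [h₁.mfderiv_eq, mfderiv_id] at h
    exact h.symm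
  -- `A ∘ B = id`
  have hAB : ∀ w, A (B w) = w := by
    intro w
    have hΦ' : MDifferentiableAt I I' Φ (Ψ (Φ x)) := by rw [hx]; exact hΦ
    have h := mfderiv_comp_apply (I' := I) (Φ x) hΦ' hΨ w
    rw [h₂.mfderiv_eq, mfderiv_id] at h
    have hpt : @Eq (E →L[ℝ] E') (mfderiv I I' Φ (Ψ (Φ x))) (mfderiv I I' Φ x) :=
      mfderiv_congr_point hx
    have h' := DFunLike.congr_fun hpt (B w)
    rw [← h']
    exact h.symm
  set e : E ≃L[ℝ] E' := ContinuousLinearEquiv.equivOfInverse A B hBA hAB with he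
  have hcoe : (e : E →L[ℝ] E') = A := rfl
  refine ⟨⟨e, hcoe⟩, ?_⟩
  show A.inverse = B
  rw [← hcoe, ContinuousLinearMap.inverse_equiv]
  refine ContinuousLinearMap.ext fun w => ?_
  rw [he, ContinuousLinearEquiv.symm_equivOfInverse]
  rfl

/-- `dΨ_{Φ x} (dΦₓ v) = v` when `Ψ ∘ Φ = id` near `x`. [cite: LeeSmoothManifolds2013, Prop. 3.6 (d)] -/
theorem mfderiv_apply_mfderiv_apply_of_eventuallyEq (hΦ : MDifferentiableAt I I' Φ x)
    (hΨ : MDifferentiableAt I' I Ψ (Φ x)) (h₁ : Ψ ∘ Φ =ᶠ[𝓝 x] id) (v : TangentSpace I x) :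
    mfderiv I' I Ψ (Φ x) (mfderiv I I' Φ x v) = v := by
  have h := mfderiv_comp_apply (I' := I') x hΨ hΦ v
  rw [h₁.mfderiv_eq, mfderiv_id] at h
  exact h.symm

set_option backward.isDefEq.respectTransparency false in
/-- **The pull-back along `Ψ` is the push-forward along its local inverse `Φ`**:
`mpullback Ψ Y p = (dΨ_p)⁻¹ (Y (Ψ p)) = dΦ_{Ψ p} (Y (Ψ p))` if `Φ ∘ Ψ = id` near `p` and
`Ψ ∘ Φ = id` near `Ψ p`. [cite: LeeSmoothManifolds2013, Prop. 8.19] -/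
theorem mpullback_apply_eq_mfderiv_apply (hΨ : MDifferentiableAt I' I Ψ p)
    (hΦ : MDifferentiableAt I I' Φ (Ψ p)) (h₁ : Φ ∘ Ψ =ᶠ[𝓝 p] id)
    (h₂ : Ψ ∘ Φ =ᶠ[𝓝 (Ψ p)] id) (Y : Π y : M, TangentSpace I y) :
    mpullback I' I Ψ Y p = mfderiv I I' Φ (Ψ p) (Y (Ψ p)) := by
  rw [mpullback_apply, (isInvertible_mfderiv_of_eventuallyEq hΨ hΦ h₁ h₂).2]
  rfl

/-- The same at a point written `Φ x`: `mpullback Ψ Y (Φ x) = dΦₓ (Y x)` for a local inverse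
pair at `x`. [cite: LeeSmoothManifolds2013, Prop. 8.19] -/
theorem mpullback_apply_eq_mfderiv (hΦ : MDifferentiableAt I I' Φ x)
    (hΨ : MDifferentiableAt I' I Ψ (Φ x)) (h₁ : Ψ ∘ Φ =ᶠ[𝓝 x] id)
    (h₂ : Φ ∘ Ψ =ᶠ[𝓝 (Φ x)] id) (Y : Π y : M, TangentSpace I y) :
    mpullback I' I Ψ Y (Φ x) = mfderiv I I' Φ x (Y x) := by
  have hx : Ψ (Φ x) = x := by
    have h := h₁.self_of_nhds
    simpa only [comp_apply, id_eq] using h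
  have hΦ' : MDifferentiableAt I I' Φ (Ψ (Φ x)) := by rw [hx]; exact hΦ
  have h₁' : Ψ ∘ Φ =ᶠ[𝓝 (Ψ (Φ x))] id := by rw [hx]; exact h₁
  rw [mpullback_apply_eq_mfderiv_apply hΨ hΦ' h₂ h₁' Y]
  -- move the base point `Ψ (Φ x)` to `x`
  have key : ∀ z : M, z = x → (mfderiv I I' Φ z (Y z) : E') = mfderiv I I' Φ x (Y x) := by
    rintro z rfl; rfl
  exact key _ hx

/-- The differential of `Ψ` is invertible at `p` if `Φ ∘ Ψ = id` near `p` and `Ψ ∘ Φ = id`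
near `Ψ p` (the hypothesis under which Mathlib's `mpullback` lemmas apply).
[cite: LeeSmoothManifolds2013, Prop. 3.6 (d)] -/
theorem isInvertible_mfderiv_of_eventuallyEq' (hΨ : MDifferentiableAt I' I Ψ p)
    (hΦ : MDifferentiableAt I I' Φ (Ψ p)) (h₁ : Φ ∘ Ψ =ᶠ[𝓝 p] id)
    (h₂ : Ψ ∘ Φ =ᶠ[𝓝 (Ψ p)] id) : (mfderiv I' I Ψ p).IsInvertible :=
  (isInvertible_mfderiv_of_eventuallyEq hΨ hΦ h₁ h₂).1

set_option backward.isDefEq.respectTransparency false in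
/-- **A local diffeomorphism carries velocity vectors to push-forward vectors**: if `γ` has
velocity `Y (γ t)` within `s` at `t` and `(Φ, Ψ)` is a local inverse pair at `γ t`, then
`Φ ∘ γ` has velocity `mpullback Ψ Y (Φ (γ t))` within `s` at `t`.
[cite: LeeSmoothManifolds2013, Prop. 9.6] -/
theorem HasMFDerivWithinAt.comp_mpullback {γ : ℝ → M} {s : Set ℝ} {t : ℝ}
    {Y : Π y : M, TangentSpace I y}
    (hγ : HasMFDerivWithinAt 𝓘(ℝ, ℝ) I γ s t ((1 : ℝ →L[ℝ] ℝ).smulRight (Y (γ t))))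
    (hΦ : MDifferentiableAt I I' Φ (γ t)) (hΨ : MDifferentiableAt I' I Ψ (Φ (γ t)))
    (h₁ : Ψ ∘ Φ =ᶠ[𝓝 (γ t)] id) (h₂ : Φ ∘ Ψ =ᶠ[𝓝 (Φ (γ t))] id) :
    HasMFDerivWithinAt 𝓘(ℝ, ℝ) I' (Φ ∘ γ) s t
      ((1 : ℝ →L[ℝ] ℝ).smulRight (mpullback I' I Ψ Y (Φ (γ t)))) := by
  have h := hΦ.hasMFDerivAt.comp_hasMFDerivWithinAt t hγ
  rw [mpullback_apply_eq_mfderiv hΦ hΨ h₁ h₂ Y]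
  refine h.congr_mfderiv ?_
  refine ContinuousLinearMap.ext fun r => ?_
  change mfderiv I I' Φ (γ t) (r • Y (γ t)) = r • mfderiv I I' Φ (γ t) (Y (γ t))
  rw [map_smul]

/-- **A local diffeomorphism carries integral curves to integral curves of the push-forward**:
if `γ` is an integral curve of `Y` on `s` and `(Φ, Ψ)` is a local inverse pair at every
`γ t`, `t ∈ s`, then `Φ ∘ γ` is an integral curve of `mpullback Ψ Y` on `s`.
[cite: LeeSmoothManifolds2013, Prop. 9.6 and Cor. 9.14] -/
theorem IsMIntegralCurveOn.comp_mpullback {γ : ℝ → M} {s : Set ℝ}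
    {Y : Π y : M, TangentSpace I y} (hγ : IsMIntegralCurveOn γ Y s)
    (hΦ : ∀ t ∈ s, MDifferentiableAt I I' Φ (γ t))
    (hΨ : ∀ t ∈ s, MDifferentiableAt I' I Ψ (Φ (γ t)))
    (h₁ : ∀ t ∈ s, Ψ ∘ Φ =ᶠ[𝓝 (γ t)] id) (h₂ : ∀ t ∈ s, Φ ∘ Ψ =ᶠ[𝓝 (Φ (γ t))] id) :
    IsMIntegralCurveOn (Φ ∘ γ) (mpullback I' I Ψ Y) s := fun t ht =>
  HasMFDerivWithinAt.comp_mpullback (hγ t ht) (hΦ t ht) (hΨ t ht) (h₁ t ht) (h₂ t ht)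

set_option backward.isDefEq.respectTransparency false in
/-- **A map intertwining two curves near `0` carries the velocity of the one to that of the
other**: if `γ` has velocity `v` at `0`, `γ'` has velocity `v'` at `0`, `Θ` is differentiable
at `γ 0` and `Θ ∘ γ = γ'` near `0`, then `dΘ (v) = v'` (uniqueness of derivatives of curves).
[cite: LeeSmoothManifolds2013, Prop. 9.6] -/
theorem mfderiv_apply_eq_of_comp_eventuallyEq {Θ : M → M'} {γ : ℝ → M} {γ' : ℝ → M'}
    {v : TangentSpace I (γ 0)} {v' : TangentSpace I' (γ' 0)}
    (hγ : HasMFDerivAt 𝓘(ℝ, ℝ) I γ 0 ((1 : ℝ →L[ℝ] ℝ).smulRight v))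
    (hγ' : HasMFDerivAt 𝓘(ℝ, ℝ) I' γ' 0 ((1 : ℝ →L[ℝ] ℝ).smulRight v'))
    (hΘ : MDifferentiableAt I I' Θ (γ 0)) (h : Θ ∘ γ =ᶠ[𝓝 0] γ') :
    mfderiv I I' Θ (γ 0) v = v' := by
  have h1 : HasMFDerivAt 𝓘(ℝ, ℝ) I' (Θ ∘ γ) 0
      ((mfderiv I I' Θ (γ 0)).comp ((1 : ℝ →L[ℝ] ℝ).smulRight v)) :=
    HasMFDerivAt.comp 0 hΘ.hasMFDerivAt hγ
  have h2 : HasMFDerivAt 𝓘(ℝ, ℝ) I' (Θ ∘ γ) 0 ((1 : ℝ →L[ℝ] ℝ).smulRight v') :=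
    hγ'.congr_of_eventuallyEq h
  have h3 := DFunLike.congr_fun (hasMFDerivAt_unique h1 h2) (1 : ℝ)
  change mfderiv I I' Θ (γ 0) ((1 : ℝ) • v) = (1 : ℝ) • v' at h3
  simpa only [one_smul] using h3

set_option backward.isDefEq.respectTransparency false in
/-- **Where `Ψ` intertwines the integral curves of `Y`, the push-forward of `Y` is `Y`.**  Let
`(Φ, Ψ)` be inverse to each other near `p` and near `Ψ p`; let `γ` be a curve through
`γ 0 = p` and `γ'` a curve through `γ' 0 = Ψ p`, with velocities `Y (γ 0)`, `Y (γ' 0)` at `0`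
(the integral curves of `Y` through `p` and `Ψ p`), and suppose `Ψ ∘ γ = γ'` near `0`.  Then
`mpullback Ψ Y p = Y p`.  (Milnor, proof of Thm. 4.4: the pushed-forward field *"coincides with
`ξ̂` near `f⁻¹(a)` and `f⁻¹(½)`"*, where `H` is a product with a fixed diffeomorphism and so
commutes with the flow `∂/∂t`.) [cite: MilnorHCobordism1965, proof of Thm. 4.4 (PDF p. 24)] -/
theorem mpullback_apply_eq_self {Y : Π y : M', TangentSpace I' y} {Φ Ψ : M' → M'}
    {γ γ' : ℝ → M'} (hΨ : MDifferentiableAt I' I' Ψ p) (hΦ : MDifferentiableAt I' I' Φ (Ψ p))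
    (h₁ : Φ ∘ Ψ =ᶠ[𝓝 p] id) (h₂ : Ψ ∘ Φ =ᶠ[𝓝 (Ψ p)] id) (hγ0 : γ 0 = p)
    (hγ : HasMFDerivAt 𝓘(ℝ, ℝ) I' γ 0 ((1 : ℝ →L[ℝ] ℝ).smulRight (Y (γ 0))))
    (hγ'0 : γ' 0 = Ψ p)
    (hγ' : HasMFDerivAt 𝓘(ℝ, ℝ) I' γ' 0 ((1 : ℝ →L[ℝ] ℝ).smulRight (Y (γ' 0))))
    (h : Ψ ∘ γ =ᶠ[𝓝 0] γ') : mpullback I' I' Ψ Y p = Y p := by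
  subst hγ0
  have key : ∀ z, γ' 0 = z →
      HasMFDerivAt 𝓘(ℝ, ℝ) I' γ' 0 ((1 : ℝ →L[ℝ] ℝ).smulRight (Y z : E')) := by
    rintro z rfl; exact hγ'
  -- `dΨ (Y p) = Y (Ψ p)`
  have hT : mfderiv I' I' Ψ (γ 0) (Y (γ 0)) = Y (Ψ (γ 0)) :=
    mfderiv_apply_eq_of_comp_eventuallyEq (v' := (Y (Ψ (γ 0)) : E')) hγ (key _ hγ'0) hΨ h
  rw [mpullback_apply, (isInvertible_mfderiv_of_eventuallyEq hΨ hΦ h₁ h₂).2, ← hT]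
  exact mfderiv_apply_mfderiv_apply_of_eventuallyEq hΨ hΦ h₁ (Y (γ 0))

set_option backward.isDefEq.respectTransparency false in
/-- **The derivative of a function along the push-forward**: for a local inverse pair
`(Φ, Ψ)` at `p` (`Φ ∘ Ψ = id` near `p`, `Ψ ∘ Φ = id` near `Ψ p`) and `g` differentiable at
`p`, `dg_p (mpullback Ψ Y p) = d(g ∘ Φ)_{Ψ p} (Y (Ψ p))`.  In particular if `Φ` preserves `g`
(`g ∘ Φ = g` near `Ψ p`) the push-forward has the same `g`-derivative as `Y`: Milnor's
*"`ξ'(f) = 1` identically"*. [cite: MilnorHCobordism1965, proof of Thm. 4.4 (PDF p. 24)] -/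
theorem mfderiv_apply_mpullback {g : M' → ℝ} (hΨ : MDifferentiableAt I' I Ψ p)
    (hΦ : MDifferentiableAt I I' Φ (Ψ p)) (h₁ : Φ ∘ Ψ =ᶠ[𝓝 p] id)
    (h₂ : Ψ ∘ Φ =ᶠ[𝓝 (Ψ p)] id) (hg : MDifferentiableAt I' 𝓘(ℝ, ℝ) g p)
    (Y : Π y : M, TangentSpace I y) :
    mfderiv I' 𝓘(ℝ, ℝ) g p (mpullback I' I Ψ Y p) =
      mfderiv I 𝓘(ℝ, ℝ) (g ∘ Φ) (Ψ p) (Y (Ψ p)) := by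
  have hp : Φ (Ψ p) = p := by
    have h := h₁.self_of_nhds
    simpa only [comp_apply, id_eq] using h
  have hg' : MDifferentiableAt I' 𝓘(ℝ, ℝ) g (Φ (Ψ p)) := by rw [hp]; exact hg
  rw [mpullback_apply_eq_mfderiv_apply hΨ hΦ h₁ h₂ Y, mfderiv_comp_apply (Ψ p) hg' hΦ]
  have hpt : @Eq (E' →L[ℝ] ℝ) (mfderiv I' 𝓘(ℝ, ℝ) g (Φ (Ψ p))) (mfderiv I' 𝓘(ℝ, ℝ) g p) :=
    mfderiv_congr_point hp
  exact (DFunLike.congr_fun hpt _).symm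

end LocalInverse

end Literature.Topology.FourManifolds
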